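import Literature.Probability.LatticeModels.GibbsSpecification
import Literature.Probability.LatticeModels.IsingModel
import HarnessLib

/-!
# The finite energy property of Ising Gibbs measures

Topic `Probability/LatticeModels`; theorems only. Georgii–Higuchi 2000 use throughout (proof of
Lemma 3.1, Step 2: "for every periodic `μ` with finite energy"; Cor. 3.2; Lemma 3.4: "the
one-point conditional probabilities of `μ` are bounded from below by `δ = [1 + e^{8β}]⁻¹`";
Lemma 5.4) the **finite energy property** of Ising Gibbs measures: changing the spins in a finite
window `Λ` costs at most a constant factor of probability, uniformly in the configuration outside.
Precisely (Burton–Keane 1989's hypothesis, in the insertion form used by the tree's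
`UniquenessInsertionTolerant.lean`): for `μ ∈ 𝒢(γ^{Ising}_{G,β,h})`, a finite `Λ`, a patch
`τ : Λ → {±1}` and every event `S`,

`μ(S) ≥ δ_Λ · μ{η | (τ on Λ, η off Λ) ∈ S}`, `δ_Λ = e^{-2|β|(|ℰ^b_Λ| + |h||Λ|)} / 2^{|Λ|} > 0`

(`IsGibbsMeasure.mul_measure_glueWith_preimage_le`). Proof: by the DLR equation
`μ(S) = ∫ μ^η_Λ(S) μ(dη)`, and `μ^η_Λ(S) ≥ μ^η_Λ({τ η_{Λᶜ}}) = w(τ)/Z ≥ δ_Λ` whenever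
`τ η_{Λᶜ} ∈ S`, since `|H^η_Λ| ≤ |ℰ^b_Λ| + |h||Λ|` (`abs_isingHamiltonian_fixed_le`).

## References

* H.-O. Georgii, Y. Higuchi, J. Math. Phys. 41 (2000), §3 (proof of Lemma 3.1, Step 2; Lemma 3.4,
  `δ = [1+e^{8β}]⁻¹`), [GeorgiiHiguchi2000].
* R. M. Burton, M. Keane, Comm. Math. Phys. 121 (1989) 501–505 (finite energy) [BurtonKeane1989].
* H.-O. Georgii, *Gibbs Measures and Phase Transitions*, 2nd ed. (2011), Def. 1.23 (DLR),
  Ex. 2.12 (Ising specification) [Georgii2011].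
-/

noncomputable section

open MeasureTheory Finset
open scoped ENNReal

namespace Literature.Probability.LatticeModels

variable {V : Type*} (G : SimpleGraph V) [DecidableEq V] [G.LocallyFinite]

/-! ### Uniform bounds on the finite-volume weights -/

/-- **Uniform bound on the fixed-boundary Hamiltonian**: `|H^η_{Λ;h}(σ)| ≤ |ℰ^b_Λ| + |h| |Λ|` for
all `η, σ` (Friedli–Velenik 2017, §3.1, (3.2): each bond and each site contributes at most `1`). [cite: FriedliVelenik2017, §3.1 eq. (3.2)] -/
theorem abs_isingHamiltonian_fixed_le (Λ : Finset V) (h : ℝ) (η σ : SpinConfig V) :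
    |isingHamiltonian G Λ h (.fixed η) σ| ≤ #(edgesTouching G Λ) + |h| * #Λ := by
  unfold isingHamiltonian
  rw [interactionEdges_fixed]
  -- `|σ_x σ_y| ≤ 1` (cf. `abs_bondSpin_le_one'`, `IsingFieldVolume.lean`)
  have hbond : ∀ e : Sym2 V, |bondSpin σ e| ≤ 1 := fun e => by
    induction e using Sym2.ind with
    | _ x y => rw [bondSpin_mk, abs_mul, abs_spinAt, abs_spinAt, one_mul]
  have h1 : |∑ e ∈ edgesTouching G Λ, bondSpin σ e| ≤ #(edgesTouching G Λ) := by
    calc |∑ e ∈ edgesTouching G Λ, bondSpin σ e| ≤ ∑ e ∈ edgesTouching G Λ, |bondSpin σ e| :=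
          abs_sum_le_sum_abs _ _
      _ ≤ ∑ _e ∈ edgesTouching G Λ, (1 : ℝ) := sum_le_sum fun e _ => hbond e
      _ = #(edgesTouching G Λ) := by simp
  have h2 : |h * ∑ x ∈ Λ, spinAt x σ| ≤ |h| * #Λ := by
    rw [abs_mul]
    refine mul_le_mul_of_nonneg_left ?_ (abs_nonneg h)
    calc |∑ x ∈ Λ, spinAt x σ| ≤ ∑ x ∈ Λ, |spinAt x σ| := abs_sum_le_sum_abs _ _
      _ = #Λ := by simp
  calc |-(∑ e ∈ edgesTouching G Λ, bondSpin σ e) - h * ∑ x ∈ Λ, spinAt x σ|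
      ≤ |-(∑ e ∈ edgesTouching G Λ, bondSpin σ e)| + |h * ∑ x ∈ Λ, spinAt x σ| := abs_sub _ _
    _ ≤ #(edgesTouching G Λ) + |h| * #Λ := by rw [abs_neg]; exact add_le_add h1 h2

/-- The **finite energy constant** `δ_Λ = exp(-2|β|(|ℰ^b_Λ| + |h||Λ|)) / 2^{|Λ|}` of the volume
`Λ` is a lower bound for every one-configuration Gibbs probability `w(τ)/Z^η_Λ`, uniformly in the
boundary condition `η` (Georgii–Higuchi 2000, Lemma 3.4: for a single site of `ℤ²` at `h = 0` the
sharper `[1 + e^{8β}]⁻¹`). [cite: GeorgiiHiguchi2000, Lemma 3.4 (proof, p. 9)] -/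
theorem finiteEnergyConst_le_isingWeight_div (Λ : Finset V) (β h : ℝ) (η : SpinConfig V)
    (τ : Λ → ℤˣ) :
    Real.exp (-(2 * |β| * (#(edgesTouching G Λ) + |h| * #Λ))) / 2 ^ #Λ ≤
      isingWeight G Λ β h (.fixed η) τ / isingPartitionFunction G Λ β h (.fixed η) := by
  set C : ℝ := #(edgesTouching G Λ) + |h| * #Λ with hC
  have hC0 : 0 ≤ C := by positivity
  -- every weight lies in `[e^{-|β|C}, e^{|β|C}]`
  have hw : ∀ τ' : Λ → ℤˣ, Real.exp (-(|β| * C)) ≤ isingWeight G Λ β h (.fixed η) τ' ∧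
      isingWeight G Λ β h (.fixed η) τ' ≤ Real.exp (|β| * C) := by
    intro τ'
    have hH := abs_isingHamiltonian_fixed_le G Λ h η (glue Λ τ' (.fixed η))
    have hb : |-β * isingHamiltonian G Λ h (.fixed η) (glue Λ τ' (.fixed η))| ≤ |β| * C := by
      rw [abs_mul, abs_neg]
      exact mul_le_mul_of_nonneg_left hH (abs_nonneg β)
    rw [abs_le] at hb
    exact ⟨Real.exp_le_exp.2 hb.1, Real.exp_le_exp.2 hb.2⟩
  have hZ : isingPartitionFunction G Λ β h (.fixed η) ≤ 2 ^ #Λ * Real.exp (|β| * C) := by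
    unfold isingPartitionFunction
    calc ∑ τ' : Λ → ℤˣ, isingWeight G Λ β h (.fixed η) τ'
        ≤ ∑ _τ' : Λ → ℤˣ, Real.exp (|β| * C) := sum_le_sum fun τ' _ => (hw τ').2
      _ = 2 ^ #Λ * Real.exp (|β| * C) := by
          rw [sum_const, card_univ, nsmul_eq_mul]
          congr 1
          rw [Fintype.card_fun, Fintype.card_units_int, Fintype.card_coe]
          push_cast
          ring
  have hZpos := isingPartitionFunction_pos G Λ β h (.fixed η)
  have hpow : (0 : ℝ) < 2 ^ #Λ := by positivity
  rw [div_le_div_iff₀ hpow hZpos]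
  calc Real.exp (-(2 * |β| * C)) * isingPartitionFunction G Λ β h (.fixed η)
      ≤ Real.exp (-(2 * |β| * C)) * (2 ^ #Λ * Real.exp (|β| * C)) :=
        mul_le_mul_of_nonneg_left hZ (Real.exp_pos _).le
    _ = Real.exp (-(|β| * C)) * 2 ^ #Λ * (Real.exp (-(|β| * C)) * Real.exp (|β| * C)) := by
        rw [show -(2 * |β| * C) = -(|β| * C) + -(|β| * C) by ring, Real.exp_add]; ring
    _ = Real.exp (-(|β| * C)) * 2 ^ #Λ := by
        rw [← Real.exp_add, neg_add_cancel, Real.exp_zero, mul_one]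
    _ ≤ isingWeight G Λ β h (.fixed η) τ * 2 ^ #Λ :=
        mul_le_mul_of_nonneg_right (hw τ).1 hpow.le

/-- The finite energy constant is positive. [folklore] -/
theorem finiteEnergyConst_pos (Λ : Finset V) (β h : ℝ) :
    0 < Real.exp (-(2 * |β| * (#(edgesTouching G Λ) + |h| * #Λ))) / 2 ^ #Λ := by
  positivity

/-! ### The finite energy inequality -/

/-- **One-configuration lower bound for the Ising kernel**: if the patched configuration
`τ η_{Λᶜ}` lies in the event `S`, then `γ_Λ(S | η) ≥ δ_Λ` (Georgii–Higuchi 2000, proof of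
Lemma 3.4: "`μ(A_N ∩ B) = μ(μ^·_{x,y}(ω(x) = ω(y) = -1) 1_B) ≥ δ² μ(B)`", the pointwise step). [cite: GeorgiiHiguchi2000, Lemma 3.4 (proof, p. 9)] -/
theorem finiteEnergyConst_le_isingSpecification_of_glueWith_mem (β h : ℝ) (Λ : Finset V)
    (η : SpinConfig V) (τ : Λ → ℤˣ) {S : Set (SpinConfig V)} (hS : glueWith Λ τ η ∈ S) :
    ENNReal.ofReal (Real.exp (-(2 * |β| * (#(edgesTouching G Λ) + |h| * #Λ))) / 2 ^ #Λ) ≤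
      isingSpecification G β h Λ η S := by
  rw [isingSpecification_apply]
  have hsub : {glue Λ τ (.fixed η)} ⊆ S := by
    rw [Set.singleton_subset_iff, glue_fixed]; exact hS
  refine le_trans ?_ (measure_mono hsub)
  rw [isingMeasure_apply_singleton_holds]
  exact ENNReal.ofReal_le_ofReal (finiteEnergyConst_le_isingWeight_div G Λ β h η τ)

omit [DecidableEq V] in
/-- The patching map `η ↦ τ η_{Λᶜ}` is measurable in the outside configuration `η` (companion
of the tree's `measurable_glueWith`, measurability in the patch). [folklore] -/
theorem measurable_glueWith_right (Λ : Finset V) (τ : Λ → ℤˣ) :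
    Measurable fun η : SpinConfig V => glueWith Λ τ η := by
  refine measurable_pi_lambda _ fun x => ?_
  by_cases hx : x ∈ Λ
  · simp only [glueWith_apply_mem _ _ _ hx]; exact measurable_const
  · simp only [glueWith_apply_not_mem _ _ _ hx]; exact measurable_pi_apply x

/-- **The finite energy property of Ising Gibbs measures** (Burton–Keane's hypothesis; used by
Georgii–Higuchi 2000 in the proof of Lemma 3.1, Step 2, Cor. 3.2, Lemma 3.4 and Lemma 5.4): for
`μ ∈ 𝒢(γ^{Ising}_{G,β,h})` on a countable locally finite graph, every finite `Λ`, patch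
`τ : Λ → {±1}` and measurable event `S`,
`δ_Λ · μ{η | τ η_{Λᶜ} ∈ S} ≤ μ(S)` with `δ_Λ = exp(-2|β|(|ℰ^b_Λ| + |h||Λ|)) / 2^{|Λ|} > 0`.
Proof: DLR and the one-configuration bound. [cite: GeorgiiHiguchi2000, Lemma 3.1 (proof, Step 2, p. 7) and Lemma 3.4 (proof, p. 9)] -/
theorem IsGibbsMeasure.mul_measure_glueWith_preimage_le {β h : ℝ} {μ : Measure (SpinConfig V)}
    (hμ : IsGibbsMeasure (isingSpecification G β h) μ) (Λ : Finset V) (τ : Λ → ℤˣ)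
    {S : Set (SpinConfig V)} (hS : MeasurableSet S) :
    ENNReal.ofReal (Real.exp (-(2 * |β| * (#(edgesTouching G Λ) + |h| * #Λ))) / 2 ^ #Λ) *
        μ {η | glueWith Λ τ η ∈ S} ≤ μ S := by
  set δ : ℝ≥0∞ :=
    ENNReal.ofReal (Real.exp (-(2 * |β| * (#(edgesTouching G Λ) + |h| * #Λ))) / 2 ^ #Λ) with hδ
  have hA : MeasurableSet {η : SpinConfig V | glueWith Λ τ η ∈ S} :=
    measurable_glueWith_right Λ τ hS
  rw [← hμ.2 Λ S hS]
  calc δ * μ {η | glueWith Λ τ η ∈ S}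
      = ∫⁻ η, {η | glueWith Λ τ η ∈ S}.indicator (fun _ => δ) η ∂μ := by
        rw [lintegral_indicator_const hA]
    _ ≤ ∫⁻ η, isingSpecification G β h Λ η S ∂μ := by
        refine lintegral_mono fun η => ?_
        by_cases hη : glueWith Λ τ η ∈ S
        · rw [Set.indicator_of_mem (show η ∈ {η | glueWith Λ τ η ∈ S} from hη)]
          exact finiteEnergyConst_le_isingSpecification_of_glueWith_mem G β h Λ η τ hη
        · rw [Set.indicator_of_notMem (show η ∉ {η | glueWith Λ τ η ∈ S} from hη)]
          exact zero_le

/-- The finite energy property in the form "positive probability is preserved by patching": if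
`μ{η | τ η_{Λᶜ} ∈ S} ≠ 0` then `μ(S) ≠ 0`. [cite: GeorgiiHiguchi2000, Lemma 3.1 (proof, Step 2, p. 7)] -/
theorem IsGibbsMeasure.measure_ne_zero_of_glueWith {β h : ℝ} {μ : Measure (SpinConfig V)}
    (hμ : IsGibbsMeasure (isingSpecification G β h) μ) (Λ : Finset V) (τ : Λ → ℤˣ)
    {S : Set (SpinConfig V)} (hS : MeasurableSet S) (hpos : μ {η | glueWith Λ τ η ∈ S} ≠ 0) :
    μ S ≠ 0 := by
  intro h0
  have h := hμ.mul_measure_glueWith_preimage_le G Λ τ hS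
  rw [h0, nonpos_iff_eq_zero, mul_eq_zero] at h
  rcases h with h | h
  · exact absurd h (ENNReal.ofReal_pos.2 (finiteEnergyConst_pos G Λ β _)).ne'
  · exact hpos h

end Literature.Probability.LatticeModels
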